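import Mathlib
import HarnessLib
import Summits.HubbardSuperconductivity.HubbardSuperconductivity.Theorems.KLProgrammeKLRegimeTwoVolumeTowerBaseTransferBlockCov
import Summits.HubbardSuperconductivity.HubbardSuperconductivity.Theorems.KLProgrammeKLRegimeTwoVolumeTowerBaseTransferRows

/-!
# Route `KLProgramme` — crux K3, VL child `KLRegimeVolumeLimitV17F2` (stmt-HubbardSuperconductivity-20440), blueprint v5 M5 / W4 base data: THE BASE-TRANSFER
# BUNDLE AT ONE INSTANCE FROM ITS ANALYTIC ATOMS (seat hubbard-kl-k3c4-p1 g14; `--supports` 20440)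

The base-transfer bundle `hdataT` of `…TowerBase.tower_base_keyedDefect_eventually_le` / `…TowerTruncOfParts.towerDataT_of_partsD` is, at one instance
`(L, b, M)` and frames `(Kc, Kf)` (in the model `Kc = K_L`, `Kf = K_{bL}`), a 7-tuple about `klBaseTransfer (bL) M β μ Kc`, its frame difference against `Kf`, and
the two grid actions.  This file assembles it from the ANALYTIC ATOMS the scale-0 lane owes (and nothing else): the `(1 + Λ_T·tnorm)`-weighted rows/columns of
the alive block `ε • E(F_0[Kc])·S_N` and of the source block `klSrcPlainBlock·S_N` (`…TowerBaseTransferRows`), the rows/columns of the frame difference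
`ε • (E(F_0[Kf]) − E(F_0[Kc]))·S_N` (`…TowerBaseTransferFrameDiff`), the two grid actions' weighted profiles (passed through), the block covariance being a theorem
(`…TowerBaseTransferBlockCov.klBaseTransfer_blockCovariant`).

* **`towerBase_transferData_of_atoms`**.

Proofs only; no definition. [cite: BenfattoGiulianiMastropietro2006, §2.7 (2.70)–(2.71a), §3 (3.3)]
-/

noncomputable section

namespace Summit.HubbardSuperconductivity.HubbardSuperconductivity.Theorems.TwoVolumeSource

set_option linter.dupNamespace false -- summit = problem name (single-conjunct summit), D-0017

open Finset Literature.MathematicalPhysics.QuantumLattice GrassmannAlgebra Literature.Probability.LatticeModels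
  Literature.Probability.LatticeModels.BattleFederbush
open Summit.HubbardSuperconductivity.HubbardSuperconductivity.Theorems.KLProgrammeLegKernels
open Summit.HubbardSuperconductivity.HubbardSuperconductivity.Theorems.KLRegimeSplit
open Summit.HubbardSuperconductivity.HubbardSuperconductivity.Theorems.EngineV8
open Summit.HubbardSuperconductivity.HubbardSuperconductivity.Theorems.TwoVolumeDefect

/-- **THE BASE-TRANSFER BUNDLE AT ONE INSTANCE FROM ITS ANALYTIC ATOMS** (see the module docstring). [cite: BenfattoGiulianiMastropietro2006, §2.7 (2.70)–(2.71a)] -/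
theorem towerBase_transferData_of_atoms {L b M : ℕ} [NeZero L] [NeZero (b * L)] [NeZero M] {β : ℝ} (hβ : β ≠ 0) (U μ : ℝ) (Kc Kf : TrigPolyC4v)
    {ΛT cgW Λg δ : ℝ} (hδ : 0 ≤ δ) (NG : ℕ → ℝ)
    -- the alive block and the source block of `klBaseTransfer (bL) M β μ Kc`: weighted rows and columns
    (hArow : ∀ Y : SpaceTimeIdx (b * L) M × SectorLeg (sectorCount 0), ∑ y : GridLeg (GridPoint (b * L) (klGridN M)),
      ‖((((imagTimeWeight β M : ℝ) : ℂ) • sectorAnalysisMatrix (b * L) M β (klAnisoFamily (b * L) M β μ Kc klE0 0)) * hubbardGridSub (b * L) M β (klGridN M)) Y y‖ *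
        (1 + ΛT * (Torus.tnorm (Y.1.2 - y.1.1.2) : ℝ)) ≤ cgW)
    (hAcol : ∀ y : GridLeg (GridPoint (b * L) (klGridN M)), ∑ Y : SpaceTimeIdx (b * L) M × SectorLeg (sectorCount 0),
      ‖((((imagTimeWeight β M : ℝ) : ℂ) • sectorAnalysisMatrix (b * L) M β (klAnisoFamily (b * L) M β μ Kc klE0 0)) * hubbardGridSub (b * L) M β (klGridN M)) Y y‖ *
        (1 + ΛT * (Torus.tnorm (Y.1.2 - y.1.1.2) : ℝ)) ≤ cgW)
    (hBrow : ∀ Y : SpaceTimeIdx (b * L) M × SectorLeg (sectorCount 0), ∑ y : GridLeg (GridPoint (b * L) (klGridN M)),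
      ‖(klSrcPlainBlock (b * L) M β * hubbardGridSub (b * L) M β (klGridN M)) Y y‖ * (1 + ΛT * (Torus.tnorm (Y.1.2 - y.1.1.2) : ℝ)) ≤ cgW)
    (hBcol : ∀ y : GridLeg (GridPoint (b * L) (klGridN M)), ∑ Y : SpaceTimeIdx (b * L) M × SectorLeg (sectorCount 0),
      ‖(klSrcPlainBlock (b * L) M β * hubbardGridSub (b * L) M β (klGridN M)) Y y‖ * (1 + ΛT * (Torus.tnorm (Y.1.2 - y.1.1.2) : ℝ)) ≤ cgW)
    -- the frame difference of the alive block: rows and columns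
    (hDrow : ∀ Y : SpaceTimeIdx (b * L) M × SectorLeg (sectorCount 0), ∑ y : GridLeg (GridPoint (b * L) (klGridN M)),
      ‖((((imagTimeWeight β M : ℝ) : ℂ) • (sectorAnalysisMatrix (b * L) M β (klAnisoFamily (b * L) M β μ Kf klE0 0) -
          sectorAnalysisMatrix (b * L) M β (klAnisoFamily (b * L) M β μ Kc klE0 0))) * hubbardGridSub (b * L) M β (klGridN M)) Y y‖ ≤ δ)
    (hDcol : ∀ y : GridLeg (GridPoint (b * L) (klGridN M)), ∑ Y : SpaceTimeIdx (b * L) M × SectorLeg (sectorCount 0),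
      ‖((((imagTimeWeight β M : ℝ) : ℂ) • (sectorAnalysisMatrix (b * L) M β (klAnisoFamily (b * L) M β μ Kf klE0 0) -
          sectorAnalysisMatrix (b * L) M β (klAnisoFamily (b * L) M β μ Kc klE0 0))) * hubbardGridSub (b * L) M β (klGridN M)) Y y‖ ≤ δ)
    -- the two grid actions' weighted profiles (passed through)
    (hGc : ∀ (k : ℕ) (p : Fin k) (y : GridLeg (GridPoint L (klGridN M))),
      ∑ Y ∈ univ.filter (fun Y : Fin k → GridLeg (GridPoint L (klGridN M)) => Y p = y),
        ‖kernel ℂ (klGridAction L M β U μ Kc) k Y‖ *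
          (1 + labelDiam (fun Y₁ Y₂ : GridLeg (GridPoint L (klGridN M)) => Λg * (Torus.tnorm (Y₁.1.1.2 - Y₂.1.1.2) : ℝ)) (univ.image Y)) ≤ imagTimeWeight β M * NG k)
    (hGf : ∀ (k : ℕ) (p : Fin k) (y : GridLeg (GridPoint (b * L) (klGridN M))),
      ∑ Y ∈ univ.filter (fun Y : Fin k → GridLeg (GridPoint (b * L) (klGridN M)) => Y p = y),
        ‖kernel ℂ (klGridAction (b * L) M β U μ Kf) k Y‖ *
          (1 + labelDiam (fun Y₁ Y₂ : GridLeg (GridPoint (b * L) (klGridN M)) => Λg * (Torus.tnorm (Y₁.1.1.2 - Y₂.1.1.2) : ℝ)) (univ.image Y)) ≤ imagTimeWeight β M * NG k) :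
    (∀ x : SrcLabel (b * L) M 0, ∑ y, ‖klBaseTransfer (b * L) M β μ Kc x y‖ * (1 + ΛT * (Torus.tnorm (x.1.1.2 - y.1.1.1.2) : ℝ)) ≤ cgW) ∧
    (∀ y : GridLeg (GridPoint (b * L) (klGridN M)) × Fin 2, ∑ x, ‖klBaseTransfer (b * L) M β μ Kc x y‖ * (1 + ΛT * (Torus.tnorm (x.1.1.2 - y.1.1.1.2) : ℝ)) ≤ cgW) ∧
    (∀ (δ' β' β₁ : Fin 2 → Fin b) (xbar : SrcLabel L M 0) (y : GridLeg (GridPoint L (klGridN M)) × Fin 2),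
      ‖klBaseTransfer (b * L) M β μ Kc ((klBlockEquivD L b M 0).symm (β' + δ', xbar)) ((klGridBlockEquivD L b M).symm (β₁ + δ', y))‖ =
        ‖klBaseTransfer (b * L) M β μ Kc ((klBlockEquivD L b M 0).symm (β', xbar)) ((klGridBlockEquivD L b M).symm (β₁, y))‖) ∧
    (∀ x, ∑ y, ‖klBaseTransfer (b * L) M β μ Kf x y - klBaseTransfer (b * L) M β μ Kc x y‖ ≤ δ) ∧
    (∀ y, ∑ x, ‖klBaseTransfer (b * L) M β μ Kf x y - klBaseTransfer (b * L) M β μ Kc x y‖ ≤ δ) ∧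
    (∀ (k : ℕ) (p : Fin k) (y : GridLeg (GridPoint L (klGridN M))),
      ∑ Y ∈ univ.filter (fun Y : Fin k → GridLeg (GridPoint L (klGridN M)) => Y p = y),
        ‖kernel ℂ (klGridAction L M β U μ Kc) k Y‖ *
          (1 + labelDiam (fun Y₁ Y₂ : GridLeg (GridPoint L (klGridN M)) => Λg * (Torus.tnorm (Y₁.1.1.2 - Y₂.1.1.2) : ℝ)) (univ.image Y)) ≤ imagTimeWeight β M * NG k) ∧
    (∀ (k : ℕ) (p : Fin k) (y : GridLeg (GridPoint (b * L) (klGridN M))),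
      ∑ Y ∈ univ.filter (fun Y : Fin k → GridLeg (GridPoint (b * L) (klGridN M)) => Y p = y),
        ‖kernel ℂ (klGridAction (b * L) M β U μ Kf) k Y‖ *
          (1 + labelDiam (fun Y₁ Y₂ : GridLeg (GridPoint (b * L) (klGridN M)) => Λg * (Torus.tnorm (Y₁.1.1.2 - Y₂.1.1.2) : ℝ)) (univ.image Y)) ≤ imagTimeWeight β M * NG k) :=
  ⟨sum_norm_klBaseTransfer_mul_wt_row_le β μ Kc ΛT cgW hArow hBrow, sum_norm_klBaseTransfer_mul_wt_col_le β μ Kc ΛT cgW hAcol hBcol,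
    klBaseTransfer_blockCovariant hβ μ Kc, sum_norm_klBaseTransfer_sub_row_le β μ Kf Kc hδ hDrow, sum_norm_klBaseTransfer_sub_col_le β μ Kf Kc hδ hDcol,
    hGc, hGf⟩

end Summit.HubbardSuperconductivity.HubbardSuperconductivity.Theorems.TwoVolumeSource

end
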